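import Literature.Geometry.Kaehler.ComplexTorusNefConePolyhedralCriterion
import Literature.Geometry.Kaehler.ComplexTorusConeOfCurvesDuality
import Literature.Analysis.Convex.RationalMinkowskiWeyl
import HarnessLib

/-!
# Bauer's (ia) ⟺ (ib): the closed cone of curves `NE̅(X)` of a complex abelian variety is rational polyhedral
# iff the nef cone `Nef(X)` is rational polyhedral — and hence (Bauer 1998, Theorem (ia) ⟺ (ii)) iff `X` is
# isogenous to a product of mutually non-isogenous abelian varieties of Picard number one

Layer `Literature/Geometry/Kaehler`, namespace `Literature.Geometry.Kaehler.ComplexTorus`; lane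
`lit-hodgefound`, seat p07 (generation 45; §5 generation 46), programme «THE NEF CONE OF AN ABELIAN VARIETY»,
file 61 of the seat lineage.  Consumed BY NAME: `ComplexTorusConeOfCurvesDuality` (file 59: `Nef(X) = NE(X)^∨`,
`IsAbelianVariety.semipos_sum_smul_iff_forall_mem_span_sum_mul_nonneg`; the bipolar `NE̅(X) = Nef(X)^∨`,
`IsAbelianVariety.closure_span_curveCoords_eq`; `sum_mul_nonneg_of_mem_closure_span_curveCoords`; coordinates
`exists_eq_sum_smul_neronSeveriGroup_of_mem_span`, `eq_of_sum_smul_neronSeveriGroup_eq`),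
`Literature/Analysis/Convex/RationalMinkowskiWeyl` (`exists_rat_generators_of_cone_le`: RATIONAL MINKOWSKI — a
real cone cut out by finitely many rational inequalities is generated by finitely many rational vectors) and
`ComplexTorusNefConePolyhedralCriterion` (file 56: Bauer's Theorem (ib) ⟺ (ic) ⟺ (ii),
`IsAbelianVariety.nefCone_polyhedral_tfae`).  Theorems only (no definition, no named fact, no instance, no
notation; net debt `0`).

THE SOURCE, VERBATIM.  Th. Bauer, *On the cone of curves of an abelian variety*, Amer. J. Math. 120 (1998),
§1 Theorem (arXiv p. 2): "Let `X` be an abelian variety over the field of complex numbers. Then the following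
conditions are equivalent: (ia) The closed cone of curves `NE̅(X)` is rational polyhedral. (ib) The nef cone
`Nef(X)` is rational polyhedral. (ic) The semi-group `NP(X)` is finitely generated. (ii) `X` is isogenous to a
product `X₁ × ⋯ × X_r` of mutually non-isogenous abelian varieties `Xᵢ` with `NS(Xᵢ) ≅ ℤ` for `1 ≤ i ≤ r`.
Note that, since on abelian varieties the nef cone coincides with the effective cone, the equivalence of (ia),
(ib) and (ic) follows from elementary properties of cones and is stated here merely for the sake of
completeness"; §4 (arXiv p. 5): "The dual of `Nef(X)` in turn is the closed cone `NE̅(X)`, so that one of these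
two cones is rational polyhedral if and only if the other is. By Gordon's Lemma this is equivalent to the
semi-group `NP(X)` being finitely generated."

THE MODEL (as in files 59, 60).  `b` a `ℤ`-basis of `NS(X)` (`n = ρ(X)`), `N₁(X)_ℝ ≅ ℝⁿ` by `z ↦ (b_j · z)_j`
(so that `N₁(X)_ℚ`, the classes of `1`-cycles with rational coefficients, is `ℚⁿ`), `[C]_b = (C · b_j)_j`,
`NE(X)_b` the `ℝ≥0`-span of the classes of the irreducible curves and `NE̅(X)_b` its closure;
`Nef(X)_b = {c ∈ ℝⁿ | H_{Σ c_j b_j} ≥ 0}` (`NS(X) ⊗ ℚ` is `ℚⁿ`).  A cone `K ⊆ ℝⁿ` is RATIONAL POLYHEDRAL when it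
is the set of REAL non-negative combinations of finitely many RATIONAL vectors (`Literature/Analysis/Convex/
RationalMinkowskiWeyl`: equivalently, cut out by finitely many rational linear inequalities).
* §1 **`NE̅(X)` RATIONAL POLYHEDRAL ⟺ `Nef(X)` RATIONAL POLYHEDRAL** in coordinates
  (`IsAbelianVariety.closure_span_curveCoords_ratPolyhedral_iff`): each direction is rational Minkowski applied
  to the dual description of the other cone;
* §2 `Nef(X)_b` rational polyhedral ⟺ Bauer's (ib) in `NS_ℝ(X)`: the nef cone is the `ℝ≥0`-span of finitely
  many classes of `NS(X)` (`nefCoords_ratPolyhedral_iff_exists_finset_span_nnreal_eq`; clearing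
  denominators turns rational generators into integral ones);
* §3 **BAUER'S THEOREM WITH (ia)** (`IsAbelianVariety.coneOfCurves_ratPolyhedral_tfae`):
  (ia) `NE̅(X)_b` rational polyhedral ⟺ `Nef(X)_b` rational polyhedral ⟺ (ib) ⟺ (ic) ⟺ (ii) (`X` isogenous to
  a product of mutually non-isogenous abelian varieties of Picard number one);
* §4 Rosoff's (1) on the cone of curves (`IsAbelianVariety.not_closure_span_curveCoords_ratPolyhedral_of_finrank_eq_sq`:
  a singular abelian variety of dimension `≥ 2` has a non-polyhedral closed cone of curves).
* §5 THE THEOREM'S CONSEQUENCES READ ON `NE̅(X)`, for every complex abelian variety (each is the corresponding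
  statement on `N(X)` of files 50–54, 56, consumed by name and transported along (ia) ⟺ (ic)):
  `IsAbelianVariety.closure_span_curveCoords_ratPolyhedral_of_finrank_eq_one` (`ρ(X) = 1 ⟹ NE̅(X)` rational
  polyhedral), `IsSimple.closure_span_curveCoords_ratPolyhedral_iff_finrank_eq_one` (PROP. 2.2: for simple
  `X ≠ 0`, `NE̅(X)` rational polyhedral ⟺ `NS(X) ≅ ℤ`), `IsIsogenous.closure_span_curveCoords_ratPolyhedral_iff`
  (LEMMA 4.1: an isogeny invariant), `IsIsogenous.not_closure_span_curveCoords_ratPolyhedral_of_prod` (PROP. 3.1 /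
  THM. 4.2: `X ∼ Y × Y`, `Y ≠ 0` ⟹ not rational polyhedral),
  `IsIsogenous.closure_span_curveCoords_ratPolyhedral_iff_not_isIsogenous_of_finrank_eq_one` and
  `IsIsogenous.closure_span_curveCoords_ratPolyhedral_iff_finrank_eq_two_of_finrank_eq_one` (ROSOFF'S (2):
  `X ∼ E₁ × E₂`, `Eᵢ` elliptic curves: rational polyhedral ⟺ `E₁ ≁ E₂` ⟺ `ρ(X) = 2`),
  `IsAbelianVariety.closure_span_curveCoords_ratPolyhedral_iff_of_isIsogenous_powers` (THM. 4.2 along a Poincaré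
  decomposition `X ∼ ∏ X_ν^{n_ν}`: rational polyhedral ⟺ all `NS(X_ν) ≅ ℤ` and `n_ν = 1`).

## References

* [Bauer1998ConeOfCurves] Th. Bauer, *On the cone of curves of an abelian variety*, Amer. J. Math. 120 (1998)
  997–1006, §1 Theorem (ia) ⟺ (ib) ⟺ (ic) ⟺ (ii), statements (1), (2) of the introduction, §2 Prop. 2.2,
  §3 Prop. 3.1, §4 Lemma 4.1, Thm. 4.2 and "one of these two cones is rational polyhedral if and only if the
  other is" (held: arXiv alg-geom/9712019, pp. 2–5).
* [HulekLaface2019PicardNumbersAV] K. Hulek, R. Laface, *On the Picard numbers of abelian varieties*, Ann. Sc.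
  Norm. Super. Pisa Cl. Sci. (5) XIX (2019) 1199–1224, §2.1 Prop. 2.2 (`ρ(X₁ × X₂) = ρ(X₁) + ρ(X₂) + rk Hom`).
* [Lange2023AbelianVarietiesComplex] H. Lange, *Abelian Varieties over the Complex Numbers*, Springer 2023,
  §2.4.4 Thm. 2.4.25 (Poincaré's complete reducibility with powers).
* [KollarMori1998] J. Kollár, S. Mori, *Birational Geometry of Algebraic Varieties*, Cambridge Tracts in
  Math. 134, CUP 1998, §1.3 Def. 1.17 (`NE_ℚ(X)`, `NE(X)`, `NE̅(X)`) (held copy, p. 19).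
* [Schrijver1986] A. Schrijver, *Theory of Linear and Integer Programming*, Wiley 1986, §7.2 Cor. 7.1a (p. 87)
  and §16.2 (9) (p. 229–230).
-/

noncomputable section

open scoped Manifold ComplexOrder NNReal InnerProductSpace
open Complex Set Function Module Filter Topology Matrix

namespace Literature.Geometry.Kaehler

namespace ComplexTorus

universe u

variable {ι : Type*} [Fintype ι] [DecidableEq ι] {E : Type u} [NormedAddCommGroup E] [InnerProductSpace ℂ E]
  [FiniteDimensional ℂ E] [MeasurableSpace E] [BorelSpace E] (Φ : (ι → ℝ) ≃L[ℝ] E) {g n : ℕ}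

/-! ### §1 (ia) ⟺ (ib): `NE̅(X)` is rational polyhedral iff `Nef(X)` is rational polyhedral -/

omit [Fintype ι] [DecidableEq ι] [FiniteDimensional ℂ E] [MeasurableSpace E] [BorelSpace E] in
/-- `(-q)` cast is `-` the cast, and `↑(-a) ⬝ᵥ x ≤ 0 ↔ 0 ≤ Σ_j x_j ↑a_j`. [folklore] -/
private theorem cast_neg_dotProduct_nonpos_iff (a : Fin n → ℚ) (x : Fin n → ℝ) :
    (fun k ↦ ((-a) k : ℝ)) ⬝ᵥ x ≤ 0 ↔ 0 ≤ ∑ j, x j * (a j : ℝ) := by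
  have h : (fun k ↦ ((-a) k : ℝ)) = -fun k ↦ (a k : ℝ) := by
    funext k
    simp only [Pi.neg_apply, Rat.cast_neg]
  rw [h, neg_dotProduct, neg_nonpos, dotProduct_comm]
  rfl

/-- **Bauer (ia) ⟺ (ib): `NE̅(X)` is rational polyhedral iff `Nef(X)` is rational polyhedral.**  In the
coordinates of a `ℤ`-basis `b` of `NS(X)` of a complex abelian variety: the closed cone of curves `NE̅(X)_b` is
the set of real non-negative combinations of finitely many RATIONAL vectors (classes of `N₁(X)_ℚ`) iff the nef
cone `Nef(X)_b` is the set of real non-negative combinations of finitely many RATIONAL vectors (classes of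
`NS(X) ⊗ ℚ`).  `⟹`: `Nef(X) = NE̅(X)^∨` is then cut out by the finitely many rational inequalities `λ · gⱼ ≥ 0`,
so rational Minkowski (`exists_rat_generators_of_cone_le`) gives rational generators; `⟸`: the same with
`NE̅(X) = Nef(X)^∨` (the bipolar theorem). [cite: Bauer1998ConeOfCurves, §1 Theorem (ia) ⟺ (ib) and §4 ("The dual of `Nef(X)` in turn is the closed cone `NE̅(X)`, so that one of these two cones is rational polyhedral if and only if the other is")]
[cite: Schrijver1986, §7.2 Cor. 7.1a (p. 87) and §16.2 (9) (p. 229–230)] -/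
theorem IsAbelianVariety.closure_span_curveCoords_ratPolyhedral_iff (hX : IsAbelianVariety Φ)
    (e : Fin (2 * g) ≃ ι) (b : Basis (Fin n) ℤ (neronSeveriGroup Φ)) :
    (∃ (m : ℕ) (q : Fin m → Fin n → ℚ),
        closure (Submodule.span ℝ≥0 {w : Fin n → ℝ | ∃ (C : Set (ComplexTorus Φ))
          (hC : HasPureDim 𝓘(ℂ, E) C 1), IsIrreducibleAnalyticSet 𝓘(ℂ, E) C ∧
            w = fun j ↦ (analyticCyclePeriod Φ hC (ofRealForm (-((b j : neronSeveriGroup Φ) : E [⋀^Fin 2]→L[ℝ] ℝ)))).re} :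
              Set (Fin n → ℝ)) =
          {w | ∃ l : Fin m → ℝ, (∀ i, 0 ≤ l i) ∧ ∑ i, l i • (fun k ↦ (q i k : ℝ)) = w}) ↔
      ∃ (m : ℕ) (q : Fin m → Fin n → ℚ),
        {c : Fin n → ℝ | ∀ v : E, 0 ≤ (∑ j, c j • ((b j : neronSeveriGroup Φ) : E [⋀^Fin 2]→L[ℝ] ℝ)) ![I • v, v]} =
          {c | ∃ l : Fin m → ℝ, (∀ i, 0 ≤ l i) ∧ ∑ i, l i • (fun k ↦ (q i k : ℝ)) = c} := by
  classical
  constructor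
  · -- `NE̅(X)_b = cone{q_i}`: `Nef(X)_b = {c | c · q_i ≥ 0 ∀ i}` is a rational H-cone
    rintro ⟨m, q, hq⟩
    obtain ⟨m', q', hq'⟩ :=
      Literature.Analysis.Convex.FarkasMinkowskiWeyl.exists_rat_generators_of_cone_le (κ := Fin n) m fun i ↦ -q i
    refine ⟨m', q', Set.ext fun c ↦ ?_⟩
    rw [Set.mem_setOf_eq, Set.mem_setOf_eq, ← hq' c, hX.semipos_sum_smul_iff_forall_mem_span_sum_mul_nonneg Φ e b c]
    simp only [cast_neg_dotProduct_nonpos_iff]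
    constructor
    · -- nef ⟹ `≥ 0` on each generator `q_i ∈ NE̅(X)_b`
      intro hc i
      have hmem : (fun k ↦ (q i k : ℝ)) ∈ closure (Submodule.span ℝ≥0 {w : Fin n → ℝ | ∃ (C : Set (ComplexTorus Φ))
          (hC : HasPureDim 𝓘(ℂ, E) C 1), IsIrreducibleAnalyticSet 𝓘(ℂ, E) C ∧
            w = fun j ↦ (analyticCyclePeriod Φ hC (ofRealForm (-((b j : neronSeveriGroup Φ) :
              E [⋀^Fin 2]→L[ℝ] ℝ)))).re} : Set (Fin n → ℝ)) := by
        rw [hq, Set.mem_setOf_eq]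
        exact ⟨fun i' ↦ if i' = i then 1 else 0, fun i' ↦ by by_cases h : i' = i <;> simp [h], by
          simp only [ite_smul, one_smul, zero_smul, Finset.sum_ite_eq', Finset.mem_univ, if_true]⟩
      have h := sum_mul_nonneg_of_mem_closure_span_curveCoords Φ b hmem
        ((hX.semipos_sum_smul_iff_forall_mem_span_sum_mul_nonneg Φ e b c).2 hc)
      simpa only [mul_comm] using h
    · -- `≥ 0` on the generators ⟹ `≥ 0` on `NE(X)_b ⊆ NE̅(X)_b = cone{q_i}`
      intro hc w hw
      have hw' : w ∈ closure (Submodule.span ℝ≥0 {w : Fin n → ℝ | ∃ (C : Set (ComplexTorus Φ))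
          (hC : HasPureDim 𝓘(ℂ, E) C 1), IsIrreducibleAnalyticSet 𝓘(ℂ, E) C ∧
            w = fun j ↦ (analyticCyclePeriod Φ hC (ofRealForm (-((b j : neronSeveriGroup Φ) :
              E [⋀^Fin 2]→L[ℝ] ℝ)))).re} : Set (Fin n → ℝ)) := subset_closure hw
      rw [hq, Set.mem_setOf_eq] at hw'
      obtain ⟨l, hl, rfl⟩ := hw'
      simp only [Finset.sum_apply, Pi.smul_apply, smul_eq_mul, Finset.mul_sum]
      rw [Finset.sum_comm]
      refine Finset.sum_nonneg fun i _ ↦ ?_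
      have h' : ∑ j, c j * (l i * (q i j : ℝ)) = l i * ∑ j, c j * (q i j : ℝ) := by
        rw [Finset.mul_sum]
        exact Finset.sum_congr rfl fun j _ ↦ by ring
      rw [h']
      exact mul_nonneg (hl i) (by simpa only [mul_comm] using hc i)
  · -- `Nef(X)_b = cone{q_i}`: `NE̅(X)_b = {w | q_i · w ≥ 0 ∀ i}` (bipolar) is a rational H-cone
    rintro ⟨m, q, hq⟩
    obtain ⟨m', q', hq'⟩ :=
      Literature.Analysis.Convex.FarkasMinkowskiWeyl.exists_rat_generators_of_cone_le (κ := Fin n) m fun i ↦ -q i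
    refine ⟨m', q', Set.ext fun w ↦ ?_⟩
    rw [hX.closure_span_curveCoords_eq Φ e b, Set.mem_setOf_eq, Set.mem_setOf_eq, ← hq' w]
    simp only [cast_neg_dotProduct_nonpos_iff]
    constructor
    · -- `≥ 0` against every nef class ⟹ against each generator `q_i ∈ Nef(X)_b`
      intro hw i
      have hqi : (fun k ↦ (q i k : ℝ)) ∈ {c : Fin n → ℝ | ∀ v : E,
          0 ≤ (∑ j, c j • ((b j : neronSeveriGroup Φ) : E [⋀^Fin 2]→L[ℝ] ℝ)) ![I • v, v]} := by
        rw [hq, Set.mem_setOf_eq]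
        exact ⟨fun i' ↦ if i' = i then 1 else 0, fun i' ↦ by by_cases h : i' = i <;> simp [h], by
          simp only [ite_smul, one_smul, zero_smul, Finset.sum_ite_eq', Finset.mem_univ, if_true]⟩
      have h := hw _ hqi
      simpa only [mul_comm] using h
    · -- `≥ 0` against the generators ⟹ against every nef class `c = Σ l_i q_i`
      intro hw c hc
      have hc' : c ∈ {c : Fin n → ℝ | ∀ v : E,
          0 ≤ (∑ j, c j • ((b j : neronSeveriGroup Φ) : E [⋀^Fin 2]→L[ℝ] ℝ)) ![I • v, v]} := hc
      rw [hq, Set.mem_setOf_eq] at hc'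
      obtain ⟨l, hl, rfl⟩ := hc'
      simp only [Finset.sum_apply, Pi.smul_apply, smul_eq_mul, Finset.sum_mul]
      rw [Finset.sum_comm]
      refine Finset.sum_nonneg fun i _ ↦ ?_
      have h' : ∑ j, l i * (q i j : ℝ) * w j = l i * ∑ j, w j * (q i j : ℝ) := by
        rw [Finset.mul_sum]
        exact Finset.sum_congr rfl fun j _ ↦ by ring
      rw [h']
      exact mul_nonneg (hl i) (hw i)

/-! ### §2 `Nef(X)_b` rational polyhedral iff the nef cone is spanned by finitely many classes of `NS(X)` -/

omit [Fintype ι] [DecidableEq ι] [FiniteDimensional ℂ E] [MeasurableSpace E] [BorelSpace E] in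
/-- Clearing denominators: a rational vector is a positive integer multiple away from an integral one. [folklore] -/
private theorem exists_pos_nat_mul_eq_int₆₁ (q : Fin n → ℚ) :
    ∃ (d : ℕ) (z : Fin n → ℤ), 0 < d ∧ ∀ k, ((d : ℚ) * q k) = z k := by
  classical
  refine ⟨∏ k, (q k).den, fun k ↦ (q k).num * ∏ k' ∈ Finset.univ.erase k, ((q k').den : ℤ),
    Finset.prod_pos fun k _ ↦ (q k).den_pos, fun k ↦ ?_⟩
  rw [Nat.cast_prod, ← Finset.mul_prod_erase Finset.univ (fun k' ↦ ((q k').den : ℚ)) (Finset.mem_univ k)]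
  push_cast
  rw [← Rat.mul_den_eq_num (q k)]
  ring

omit [Fintype ι] [DecidableEq ι] [FiniteDimensional ℂ E] [MeasurableSpace E] [BorelSpace E] in
/-- An integral combination of the basis classes, read on the forms. [folklore] -/
private theorem coe_sum_zsmul₆₁ (b : Basis (Fin n) ℤ (neronSeveriGroup Φ)) (z : Fin n → ℤ) :
    (((∑ k, z k • b k : neronSeveriGroup Φ)) : E [⋀^Fin 2]→L[ℝ] ℝ) =
      ∑ k, (z k : ℝ) • ((b k : neronSeveriGroup Φ) : E [⋀^Fin 2]→L[ℝ] ℝ) := by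
  rw [AddSubgroup.val_finsetSum]
  refine Finset.sum_congr rfl fun k _ ↦ ?_
  rw [AddSubgroup.coe_zsmul]
  exact (Int.cast_smul_eq_zsmul ℝ _ _).symm

omit [Fintype ι] [DecidableEq ι] [FiniteDimensional ℂ E] [MeasurableSpace E] [BorelSpace E] in
/-- `Σ_i l_i (Σ_k z_{ik} b_k) = Σ_k (Σ_i l_i z_{ik}) b_k`. [folklore] -/
private theorem sum_smul_coe_sum_zsmul₆₁ (b : Basis (Fin n) ℤ (neronSeveriGroup Φ)) {m : ℕ} (z : Fin m → Fin n → ℤ)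
    (l : Fin m → ℝ) :
    ∑ i, l i • (((∑ k, z i k • b k : neronSeveriGroup Φ)) : E [⋀^Fin 2]→L[ℝ] ℝ) =
      ∑ k, (∑ i, l i * (z i k : ℝ)) • ((b k : neronSeveriGroup Φ) : E [⋀^Fin 2]→L[ℝ] ℝ) := by
  simp only [coe_sum_zsmul₆₁, Finset.smul_sum, smul_smul, Finset.sum_smul]
  rw [Finset.sum_comm]

omit [DecidableEq ι] [FiniteDimensional ℂ E] [MeasurableSpace E] [BorelSpace E] in
/-- **(ib) in coordinates ⟺ (ib) in `NS_ℝ(X)`**: the nef cone `Nef(X)_b ⊆ ℝⁿ` is the set of real non-negative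
combinations of finitely many RATIONAL vectors iff the nef cone `Nef(X) ⊆ NS_ℝ(X)` is the `ℝ≥0`-span of
finitely many classes of `NS(X)` (Bauer's "(ib) The nef cone `Nef(X)` is rational polyhedral", the first item of
`IsAbelianVariety.nefCone_polyhedral_tfae`) — along the isomorphism `c ↦ Σ c_k b_k`, clearing the denominators of
rational generators (`d q ∈ ℤⁿ`, `d > 0`, generates the same ray); this equivalence holds on every complex
torus. [cite: Bauer1998ConeOfCurves, §1 Theorem (ib) and §4 (`NS_ℝ(X) = NS(X) ⊗ ℝ`)] -/
theorem nefCoords_ratPolyhedral_iff_exists_finset_span_nnreal_eq (b : Basis (Fin n) ℤ (neronSeveriGroup Φ)) :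
    (∃ (m : ℕ) (q : Fin m → Fin n → ℚ),
        {c : Fin n → ℝ | ∀ v : E, 0 ≤ (∑ j, c j • ((b j : neronSeveriGroup Φ) : E [⋀^Fin 2]→L[ℝ] ℝ)) ![I • v, v]} =
          {c | ∃ l : Fin m → ℝ, (∀ i, 0 ≤ l i) ∧ ∑ i, l i • (fun k ↦ (q i k : ℝ)) = c}) ↔
      ∃ S : Finset (E [⋀^Fin 2]→L[ℝ] ℝ), (∀ η ∈ S, IsNSForm Φ η) ∧
        (Submodule.span ℝ≥0 (S : Set (E [⋀^Fin 2]→L[ℝ] ℝ)) : Set (E [⋀^Fin 2]→L[ℝ] ℝ)) =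
          {θ | θ ∈ Submodule.span ℝ {η : E [⋀^Fin 2]→L[ℝ] ℝ | IsNSForm Φ η} ∧ ∀ v : E, 0 ≤ θ ![I • v, v]} := by
  classical
  constructor
  · rintro ⟨m, q, hq⟩
    -- integral generators `η_i = Σ_k z_{ik} b_k`, `z_i = d_i q_i`
    choose d z hd hz using fun i ↦ exists_pos_nat_mul_eq_int₆₁ (q i)
    have hzq : ∀ i k, (z i k : ℝ) = (d i : ℝ) * (q i k : ℝ) := fun i k ↦ by
      have h := congrArg (fun r : ℚ ↦ (r : ℝ)) (hz i k)
      simp only [Rat.cast_mul, Rat.cast_natCast, Rat.cast_intCast] at h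
      exact h.symm
    refine ⟨Finset.univ.image fun i ↦ (((∑ k, z i k • b k : neronSeveriGroup Φ)) : E [⋀^Fin 2]→L[ℝ] ℝ), ?_, ?_⟩
    · simp only [Finset.forall_mem_image, Finset.mem_univ, true_implies]
      exact fun i ↦ (mem_neronSeveriGroup_iff Φ).1 (∑ k, z i k • b k : neronSeveriGroup Φ).2
    rw [Finset.coe_image, Finset.coe_univ, Set.image_univ]
    ext θ
    rw [SetLike.mem_coe, Submodule.mem_span_range_iff_exists_fun, Set.mem_setOf_eq]
    constructor
    · -- a non-negative combination of the `η_i` is a nef class of `NS_ℝ(X)`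
      rintro ⟨μ, rfl⟩
      have hsum : ∑ i, μ i • (((∑ k, z i k • b k : neronSeveriGroup Φ)) : E [⋀^Fin 2]→L[ℝ] ℝ) =
          ∑ k, (∑ i, (μ i : ℝ) * (z i k : ℝ)) • ((b k : neronSeveriGroup Φ) : E [⋀^Fin 2]→L[ℝ] ℝ) := by
        rw [← sum_smul_coe_sum_zsmul₆₁ Φ b z fun i ↦ (μ i : ℝ)]
        exact Finset.sum_congr rfl fun i _ ↦ NNReal.smul_def _ _
      rw [hsum]
      refine ⟨sum_smul_neronSeveriGroup_mem_span Φ b _, ?_⟩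
      -- its coordinate vector `Σ_i μ_i d_i q_i` lies in `cone{q_i} = Nef(X)_b`
      have hmem : (fun k ↦ ∑ i, (μ i : ℝ) * (z i k : ℝ)) ∈
          {c : Fin n → ℝ | ∃ l : Fin m → ℝ, (∀ i, 0 ≤ l i) ∧ ∑ i, l i • (fun k ↦ (q i k : ℝ)) = c} := by
        refine ⟨fun i ↦ (μ i : ℝ) * d i, fun i ↦ mul_nonneg (μ i).2 (Nat.cast_nonneg _), ?_⟩
        funext k
        simp only [Finset.sum_apply, Pi.smul_apply, smul_eq_mul, hzq, mul_assoc]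
      rw [← hq, Set.mem_setOf_eq] at hmem
      exact hmem
    · -- a nef class of `NS_ℝ(X)` has coordinates in `cone{q_i}`, i.e. is `Σ (l_i / d_i) η_i`
      rintro ⟨hθ, hpos⟩
      obtain ⟨c, rfl⟩ := exists_eq_sum_smul_neronSeveriGroup_of_mem_span Φ b hθ
      have hc : c ∈ {c : Fin n → ℝ | ∃ l : Fin m → ℝ, (∀ i, 0 ≤ l i) ∧ ∑ i, l i • (fun k ↦ (q i k : ℝ)) = c} := by
        rw [← hq, Set.mem_setOf_eq]
        exact hpos
      obtain ⟨l, hl, hlc⟩ := hc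
      have hsum : ∑ i, (⟨l i / d i, div_nonneg (hl i) (Nat.cast_nonneg _)⟩ : ℝ≥0) •
            (((∑ k, z i k • b k : neronSeveriGroup Φ)) : E [⋀^Fin 2]→L[ℝ] ℝ) =
          ∑ k, (∑ i, (l i / d i) * (z i k : ℝ)) • ((b k : neronSeveriGroup Φ) : E [⋀^Fin 2]→L[ℝ] ℝ) := by
        rw [← sum_smul_coe_sum_zsmul₆₁ Φ b z fun i ↦ l i / d i]
        exact Finset.sum_congr rfl fun i _ ↦ NNReal.smul_def _ _
      have key : ∑ i, (⟨l i / d i, div_nonneg (hl i) (Nat.cast_nonneg _)⟩ : ℝ≥0) •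
            (((∑ k, z i k • b k : neronSeveriGroup Φ)) : E [⋀^Fin 2]→L[ℝ] ℝ) =
          ∑ j, c j • ((b j : neronSeveriGroup Φ) : E [⋀^Fin 2]→L[ℝ] ℝ) := by
        rw [hsum]
        refine Finset.sum_congr rfl fun k _ ↦ ?_
        congr 1
        have hk := congrFun hlc k
        simp only [Finset.sum_apply, Pi.smul_apply, smul_eq_mul] at hk
        rw [← hk]
        refine Finset.sum_congr rfl fun i _ ↦ ?_
        rw [hzq, ← mul_assoc, div_mul_cancel₀ _ (Nat.cast_ne_zero.2 (hd i).ne')]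
      exact ⟨_, key⟩
  · rintro ⟨S, hS, hspan⟩
    -- the classes in `S` have integral coordinates `z_η = b.equivFun η`
    obtain ⟨a, ha⟩ : ∃ a : Fin S.card → E [⋀^Fin 2]→L[ℝ] ℝ, Set.range a = (S : Set (E [⋀^Fin 2]→L[ℝ] ℝ)) :=
      ⟨fun i ↦ (S.equivFin.symm i : E [⋀^Fin 2]→L[ℝ] ℝ), by
        ext x; constructor
        · rintro ⟨i, rfl⟩; exact (S.equivFin.symm i).2
        · intro hx; exact ⟨S.equivFin ⟨x, hx⟩, by simp⟩⟩
    have haNS : ∀ i, IsNSForm Φ (a i) := fun i ↦ hS _ (by rw [← Finset.mem_coe, ← ha]; exact ⟨i, rfl⟩)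
    set z : Fin S.card → Fin n → ℤ := fun i ↦ b.equivFun ⟨a i, (mem_neronSeveriGroup_iff Φ).2 (haNS i)⟩ with hz
    have ha_eq : ∀ i, a i = ∑ k, (z i k : ℝ) • ((b k : neronSeveriGroup Φ) : E [⋀^Fin 2]→L[ℝ] ℝ) := fun i ↦ by
      have h := b.sum_equivFun ⟨a i, (mem_neronSeveriGroup_iff Φ).2 (haNS i)⟩
      have h' := congrArg (fun x : neronSeveriGroup Φ ↦ (x : E [⋀^Fin 2]→L[ℝ] ℝ)) h
      simp only at h'
      rw [coe_sum_zsmul₆₁] at h'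
      exact h'.symm
    refine ⟨S.card, fun i k ↦ (z i k : ℚ), Set.ext fun c ↦ ?_⟩
    rw [Set.mem_setOf_eq, Set.mem_setOf_eq]
    -- `c ∈ Nef(X)_b ⟺ Σ c_k b_k ∈ Nef(X) = span_{ℝ≥0} S ⟺ Σ c_k b_k = Σ μ_i a_i ⟺ c = Σ μ_i z_i`
    have hiff : (∀ v : E, 0 ≤ (∑ j, c j • ((b j : neronSeveriGroup Φ) : E [⋀^Fin 2]→L[ℝ] ℝ)) ![I • v, v]) ↔
        ∑ j, c j • ((b j : neronSeveriGroup Φ) : E [⋀^Fin 2]→L[ℝ] ℝ) ∈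
          (Submodule.span ℝ≥0 (S : Set (E [⋀^Fin 2]→L[ℝ] ℝ)) : Set (E [⋀^Fin 2]→L[ℝ] ℝ)) := by
      rw [hspan, Set.mem_setOf_eq]
      exact ⟨fun h ↦ ⟨sum_smul_neronSeveriGroup_mem_span Φ b c, h⟩, fun h ↦ h.2⟩
    rw [hiff, ← ha, SetLike.mem_coe, Submodule.mem_span_range_iff_exists_fun]
    have hcomb : ∀ l : Fin S.card → ℝ, ∑ i, l i • a i =
        ∑ k, (∑ i, l i * (z i k : ℝ)) • ((b k : neronSeveriGroup Φ) : E [⋀^Fin 2]→L[ℝ] ℝ) := fun l ↦ by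
      simp only [ha_eq, Finset.smul_sum, smul_smul, Finset.sum_smul]
      rw [Finset.sum_comm]
    constructor
    · rintro ⟨μ, hμ⟩
      refine ⟨fun i ↦ (μ i : ℝ), fun i ↦ (μ i).2, ?_⟩
      have hμ' : ∑ i, (μ i : ℝ) • a i = ∑ j, c j • ((b j : neronSeveriGroup Φ) : E [⋀^Fin 2]→L[ℝ] ℝ) := by
        rw [← hμ]
        exact Finset.sum_congr rfl fun i _ ↦ (NNReal.smul_def _ _).symm
      rw [hcomb] at hμ'
      have hcoef := eq_of_sum_smul_neronSeveriGroup_eq Φ b hμ'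
      funext k
      rw [← congrFun hcoef k]
      simp only [Finset.sum_apply, Pi.smul_apply, smul_eq_mul, Rat.cast_intCast]
    · rintro ⟨l, hl, hlc⟩
      have h1 : ∑ i, (⟨l i, hl i⟩ : ℝ≥0) • a i = ∑ i, l i • a i :=
        Finset.sum_congr rfl fun i _ ↦ NNReal.smul_def _ _
      have key : ∑ i, (⟨l i, hl i⟩ : ℝ≥0) • a i = ∑ j, c j • ((b j : neronSeveriGroup Φ) : E [⋀^Fin 2]→L[ℝ] ℝ) := by
        rw [h1, hcomb]
        refine Finset.sum_congr rfl fun k _ ↦ ?_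
        congr 1
        have hk := congrFun hlc k
        simp only [Finset.sum_apply, Pi.smul_apply, smul_eq_mul, Rat.cast_intCast] at hk
        exact hk
      exact ⟨_, key⟩

/-! ### §3 Bauer's Theorem with (ia): the closed cone of curves -/

/-- **Bauer 1998, §1 Theorem: (ia) ⟺ (ib) ⟺ (ic) ⟺ (ii).** "Let `X` be an abelian variety over the field of
complex numbers. Then the following conditions are equivalent: (ia) The closed cone of curves `NE̅(X)` is
rational polyhedral. (ib) The nef cone `Nef(X)` is rational polyhedral. (ic) The semi-group `NP(X)` is finitely
generated. (ii) `X` is isogenous to a product `X₁ × ⋯ × X_r` of mutually non-isogenous abelian varieties `Xᵢ`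
with `NS(Xᵢ) ≅ ℤ`."  For a complex abelian variety `X = E/Φ(ℤ^ι)` and a `ℤ`-basis `b` of `NS(X)`, the following
are equivalent: (ia) the closed cone of curves `NE̅(X)_b ⊆ N₁(X)_ℝ = ℝⁿ` is rational polyhedral; (ib, in
coordinates) the nef cone `Nef(X)_b ⊆ ℝⁿ` is rational polyhedral; (ib) `Nef(X) ⊆ NS_ℝ(X)` is the `ℝ≥0`-span of
finitely many classes of `NS(X)`; (ic) the nef (= effective) classes in `NS(X)` form a finitely generated
monoid; (ii) `X` is isogenous to a product of mutually non-isogenous abelian varieties of Picard number one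
(the last three items and their equivalence are `IsAbelianVariety.nefCone_polyhedral_tfae`). [cite: Bauer1998ConeOfCurves, §1 Theorem ((ia) ⟺ (ib) ⟺ (ic) ⟺ (ii))] -/
theorem IsAbelianVariety.coneOfCurves_ratPolyhedral_tfae (hX : IsAbelianVariety Φ) (e : Fin (2 * g) ≃ ι)
    (b : Basis (Fin n) ℤ (neronSeveriGroup Φ)) :
    List.TFAE
      [ ∃ (m : ℕ) (q : Fin m → Fin n → ℚ),
          closure (Submodule.span ℝ≥0 {w : Fin n → ℝ | ∃ (C : Set (ComplexTorus Φ))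
            (hC : HasPureDim 𝓘(ℂ, E) C 1), IsIrreducibleAnalyticSet 𝓘(ℂ, E) C ∧
              w = fun j ↦ (analyticCyclePeriod Φ hC (ofRealForm (-((b j : neronSeveriGroup Φ) : E [⋀^Fin 2]→L[ℝ] ℝ)))).re} :
                Set (Fin n → ℝ)) =
            {w | ∃ l : Fin m → ℝ, (∀ i, 0 ≤ l i) ∧ ∑ i, l i • (fun k ↦ (q i k : ℝ)) = w},
        ∃ (m : ℕ) (q : Fin m → Fin n → ℚ),
          {c : Fin n → ℝ | ∀ v : E, 0 ≤ (∑ j, c j • ((b j : neronSeveriGroup Φ) : E [⋀^Fin 2]→L[ℝ] ℝ)) ![I • v, v]} =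
            {c | ∃ l : Fin m → ℝ, (∀ i, 0 ≤ l i) ∧ ∑ i, l i • (fun k ↦ (q i k : ℝ)) = c},
        ∃ S : Finset (E [⋀^Fin 2]→L[ℝ] ℝ), (∀ η ∈ S, IsNSForm Φ η) ∧
          (Submodule.span ℝ≥0 (S : Set (E [⋀^Fin 2]→L[ℝ] ℝ)) : Set (E [⋀^Fin 2]→L[ℝ] ℝ)) =
            {θ | θ ∈ Submodule.span ℝ {η : E [⋀^Fin 2]→L[ℝ] ℝ | IsNSForm Φ η} ∧ ∀ v : E, 0 ≤ θ ![I • v, v]},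
        ∃ S : Finset (E [⋀^Fin 2]→L[ℝ] ℝ),
          (AddSubmonoid.closure (S : Set (E [⋀^Fin 2]→L[ℝ] ℝ)) : Set (E [⋀^Fin 2]→L[ℝ] ℝ)) =
            {η | IsNSForm Φ η ∧ ∀ v : E, 0 ≤ η ![I • v, v]},
        ∃ (r : ℕ) (V : Fin r → Submodule ℝ (ι → ℝ)) (hV : ∀ ν, IsLatticeSubspace (V ν))
          (hVc : ∀ ν, IsComplexSubspace Φ (V ν)),
          (∀ ν ν', ν ≠ ν' → ¬ IsIsogenous (subtorusPeriod Φ (V ν) (hV ν) (hVc ν))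
            (subtorusPeriod Φ (V ν') (hV ν') (hVc ν'))) ∧
          (∀ ν, finrank ℤ (neronSeveriGroup (subtorusPeriod Φ (V ν) (hV ν) (hVc ν))) = 1) ∧
          IsIsogenous Φ (sigmaPiPeriod fun ν ↦ subtorusPeriod Φ (V ν) (hV ν) (hVc ν)) ] := by
  have h := hX.nefCone_polyhedral_tfae
  tfae_have 1 ↔ 2 := hX.closure_span_curveCoords_ratPolyhedral_iff Φ e b
  tfae_have 2 ↔ 3 := nefCoords_ratPolyhedral_iff_exists_finset_span_nnreal_eq Φ b
  tfae_have 3 ↔ 4 := h.out 0 1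
  tfae_have 4 ↔ 5 := h.out 1 2
  tfae_finish

/-! ### §4 Rosoff's statement (1) for the cone of curves -/

/-- **Bauer §1 (1) (Rosoff), read on the cone of curves**: "If `X` is a singular abelian variety, i.e. if
`rk NS(X) = (dim X)²`, and if `dim X ≥ 2`, then `NP(X)` is not finitely generated" — hence, by the Theorem
((ia) ⟺ (ic)), the closed cone of curves `NE̅(X)` of a singular abelian variety of dimension `≥ 2` is NOT rational
polyhedral (in the coordinates of any `ℤ`-basis of `NS(X)`). [cite: Bauer1998ConeOfCurves, §1 (1) and Theorem ((ia) ⟺ (ic)); "statement (1) follows from the theorem plus the fact that by [ShiMit74] a singular abelian variety is isogenous to a product `Eⁿ`"] -/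
theorem IsAbelianVariety.not_closure_span_curveCoords_ratPolyhedral_of_finrank_eq_sq (hX : IsAbelianVariety Φ)
    (e : Fin (2 * g) ≃ ι) (b : Basis (Fin n) ℤ (neronSeveriGroup Φ))
    (hρ : finrank ℤ (neronSeveriGroup Φ) = (finrank ℂ E) ^ 2) (hg : 2 ≤ finrank ℂ E) :
    ¬ ∃ (m : ℕ) (q : Fin m → Fin n → ℚ),
        closure (Submodule.span ℝ≥0 {w : Fin n → ℝ | ∃ (C : Set (ComplexTorus Φ))
          (hC : HasPureDim 𝓘(ℂ, E) C 1), IsIrreducibleAnalyticSet 𝓘(ℂ, E) C ∧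
            w = fun j ↦ (analyticCyclePeriod Φ hC (ofRealForm (-((b j : neronSeveriGroup Φ) : E [⋀^Fin 2]→L[ℝ] ℝ)))).re} :
              Set (Fin n → ℝ)) =
          {w | ∃ l : Fin m → ℝ, (∀ i, 0 ≤ l i) ∧ ∑ i, l i • (fun k ↦ (q i k : ℝ)) = w} := fun h ↦
  not_exists_finset_addSubmonoidClosure_eq_of_finrank_neronSeveriGroup_eq_sq Φ hρ hg
    (((hX.coneOfCurves_ratPolyhedral_tfae Φ e b).out 0 3).1 h)

/-! ### §5 The closed cone of curves of every abelian variety: Picard number one, simple varieties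
(Prop. 2.2), isogeny invariance (Lemma 4.1), self-products (Prop. 3.1), two elliptic curves (Rosoff (2)),
and Thm. 4.2 along a Poincaré decomposition — the Theorem's consequences read on `NE̅(X)` -/

/-- **(ii) ⟹ (ia) with `r = 1`: an abelian variety with `NS(X) ≅ ℤ` has a rational polyhedral closed cone of
curves.**  If `ρ(X) = 1` then `N(X) = ℤ⁺·[M]` for a polarisation `M` (file 50,
`exists_addSubmonoidClosure_singleton_eq_of_finrank_eq_one`: Thm. 4.2, "if", `r = 1`), i.e. (ic) holds, hence
(ia) by the Theorem. (`X ≠ 0` is automatic: the zero torus has `NS = 0`.) [cite: Bauer1998ConeOfCurves, §1 Theorem ((ii) ⟹ (ia), the case `r = 1`) and §4 Thm. 4.2 ("if" half)] -/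
theorem IsAbelianVariety.closure_span_curveCoords_ratPolyhedral_of_finrank_eq_one (hX : IsAbelianVariety Φ)
    (e : Fin (2 * g) ≃ ι) (b : Basis (Fin n) ℤ (neronSeveriGroup Φ)) (h1 : finrank ℤ (neronSeveriGroup Φ) = 1) :
    ∃ (m : ℕ) (q : Fin m → Fin n → ℚ),
      closure (Submodule.span ℝ≥0 {w : Fin n → ℝ | ∃ (C : Set (ComplexTorus Φ))
        (hC : HasPureDim 𝓘(ℂ, E) C 1), IsIrreducibleAnalyticSet 𝓘(ℂ, E) C ∧
          w = fun j ↦ (analyticCyclePeriod Φ hC (ofRealForm (-((b j : neronSeveriGroup Φ) : E [⋀^Fin 2]→L[ℝ] ℝ)))).re} :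
            Set (Fin n → ℝ)) =
        {w | ∃ l : Fin m → ℝ, (∀ i, 0 ≤ l i) ∧ ∑ i, l i • (fun k ↦ (q i k : ℝ)) = w} := by
  classical
  haveI : Nonempty ι := nonempty_of_finrank_neronSeveriGroup_ne_zero Φ (by rw [h1]; exact one_ne_zero)
  haveI : Nontrivial E := Module.nontrivial_of_finrank_pos (finrank_pos_of_nonempty Φ)
  obtain ⟨M, -, hM⟩ := exists_addSubmonoidClosure_singleton_eq_of_finrank_eq_one Φ hX h1
  have hic : ∃ S : Finset (E [⋀^Fin 2]→L[ℝ] ℝ),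
      (AddSubmonoid.closure (S : Set (E [⋀^Fin 2]→L[ℝ] ℝ)) : Set (E [⋀^Fin 2]→L[ℝ] ℝ)) =
        {η | IsNSForm Φ η ∧ ∀ v : E, 0 ≤ η ![I • v, v]} :=
    ⟨{M}, by rw [Finset.coe_singleton]; exact hM⟩
  exact ((hX.coneOfCurves_ratPolyhedral_tfae Φ e b).out 0 3).2 hic

/-- **Prop. 2.2 read on the cone of curves: for a SIMPLE abelian variety `X ≠ 0`, `NE̅(X)` is rational
polyhedral iff `NS(X) ≅ ℤ`.**  "Let `X` be a simple abelian variety such that `N(X)` is finitely generated.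
Then `NS(X) ≅ ℤ`" (file 50, `IsSimple.exists_addSubmonoidClosure_eq_iff_finrank_eq_one`, together with the
converse Thm. 4.2, "if", `r = 1`), transported along (ia) ⟺ (ic). [cite: Bauer1998ConeOfCurves, §2 Prop. 2.2 and §1 Theorem ((ia) ⟺ (ic))] -/
theorem IsSimple.closure_span_curveCoords_ratPolyhedral_iff_finrank_eq_one [Nontrivial E] (hS : IsSimple Φ)
    (hX : IsAbelianVariety Φ) (e : Fin (2 * g) ≃ ι) (b : Basis (Fin n) ℤ (neronSeveriGroup Φ)) :
    (∃ (m : ℕ) (q : Fin m → Fin n → ℚ),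
        closure (Submodule.span ℝ≥0 {w : Fin n → ℝ | ∃ (C : Set (ComplexTorus Φ))
          (hC : HasPureDim 𝓘(ℂ, E) C 1), IsIrreducibleAnalyticSet 𝓘(ℂ, E) C ∧
            w = fun j ↦ (analyticCyclePeriod Φ hC (ofRealForm (-((b j : neronSeveriGroup Φ) : E [⋀^Fin 2]→L[ℝ] ℝ)))).re} :
              Set (Fin n → ℝ)) =
          {w | ∃ l : Fin m → ℝ, (∀ i, 0 ≤ l i) ∧ ∑ i, l i • (fun k ↦ (q i k : ℝ)) = w}) ↔
      finrank ℤ (neronSeveriGroup Φ) = 1 := by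
  exact ((hX.coneOfCurves_ratPolyhedral_tfae Φ e b).out 0 3).trans
    (hS.exists_addSubmonoidClosure_eq_iff_finrank_eq_one Φ hX)

universe u'

variable {ι' : Type*} [Fintype ι'] [DecidableEq ι'] {E' : Type u'} [NormedAddCommGroup E'] [InnerProductSpace ℂ E']
  [FiniteDimensional ℂ E'] [MeasurableSpace E'] [BorelSpace E'] (Φ' : (ι' → ℝ) ≃L[ℝ] E') {g' n' : ℕ}

/-- **Lemma 4.1 read on the cone of curves: rational polyhedrality of `NE̅(X)` is an isogeny invariant of
complex abelian varieties.**  "Let `X` and `Y` be isogenous abelian varieties. Then `N(X)` is finitely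
generated if and only if `N(Y)` is" (file 51, `IsIsogenous.exists_finset_addSubmonoidClosure_eq_iff`),
transported along (ia) ⟺ (ic) on both sides (in the coordinates of any `ℤ`-bases of `NS(X)`, `NS(Y)`; `Y` is
an abelian variety because `X` is). [cite: Bauer1998ConeOfCurves, §4 Lemma 4.1 and §1 Theorem ((ia) ⟺ (ic))] -/
theorem IsIsogenous.closure_span_curveCoords_ratPolyhedral_iff {Φ : (ι → ℝ) ≃L[ℝ] E} (h : IsIsogenous Φ Φ')
    (hX : IsAbelianVariety Φ) (e : Fin (2 * g) ≃ ι) (b : Basis (Fin n) ℤ (neronSeveriGroup Φ))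
    (e' : Fin (2 * g') ≃ ι') (b' : Basis (Fin n') ℤ (neronSeveriGroup Φ')) :
    (∃ (m : ℕ) (q : Fin m → Fin n → ℚ),
        closure (Submodule.span ℝ≥0 {w : Fin n → ℝ | ∃ (C : Set (ComplexTorus Φ))
          (hC : HasPureDim 𝓘(ℂ, E) C 1), IsIrreducibleAnalyticSet 𝓘(ℂ, E) C ∧
            w = fun j ↦ (analyticCyclePeriod Φ hC (ofRealForm (-((b j : neronSeveriGroup Φ) : E [⋀^Fin 2]→L[ℝ] ℝ)))).re} :
              Set (Fin n → ℝ)) =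
          {w | ∃ l : Fin m → ℝ, (∀ i, 0 ≤ l i) ∧ ∑ i, l i • (fun k ↦ (q i k : ℝ)) = w}) ↔
      ∃ (m : ℕ) (q : Fin m → Fin n' → ℚ),
        closure (Submodule.span ℝ≥0 {w : Fin n' → ℝ | ∃ (C : Set (ComplexTorus Φ'))
          (hC : HasPureDim 𝓘(ℂ, E') C 1), IsIrreducibleAnalyticSet 𝓘(ℂ, E') C ∧
            w = fun j ↦ (analyticCyclePeriod Φ' hC (ofRealForm (-((b' j : neronSeveriGroup Φ') : E' [⋀^Fin 2]→L[ℝ] ℝ)))).re} :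
              Set (Fin n' → ℝ)) =
          {w | ∃ l : Fin m → ℝ, (∀ i, 0 ≤ l i) ∧ ∑ i, l i • (fun k ↦ (q i k : ℝ)) = w} := by
  have hX' : IsAbelianVariety Φ' := h.isAbelianVariety_iff.1 hX
  exact (((hX.coneOfCurves_ratPolyhedral_tfae Φ e b).out 0 3).trans
    (h.exists_finset_addSubmonoidClosure_eq_iff Φ Φ')).trans
      ((hX'.coneOfCurves_ratPolyhedral_tfae Φ' e' b').out 0 3).symm

variable {κ : Type*} [Fintype κ] [DecidableEq κ] {F : Type*} [NormedAddCommGroup F] [NormedSpace ℂ F]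
  (Ψ : (κ → ℝ) ≃L[ℝ] F)

/-- **Prop. 3.1 / Thm. 4.2 (no repeated factor) read on the cone of curves: no complex abelian variety
isogenous to a self-product `Y × Y`, `Y ≠ 0`, has a rational polyhedral closed cone of curves** — in
particular `NE̅(Y × Y)` itself is not rational polyhedral ("since `NS(X × X)` is of rank `≥ 3` …"; file 52,
`IsIsogenous.not_exists_finset_addSubmonoidClosure_eq_of_prod`, transported along (ia) ⟺ (ic); stated for
any torus `X ∼ Y × Y` so that the ambient hermitian space of `X` is arbitrary). [cite: Bauer1998ConeOfCurves, §3 Prop. 3.1, §4 Thm. 4.2 ("if a multiple factor `Xᵢ` appeared … `N(Xᵢ × Xᵢ)` would be finitely generated, which however is impossible") and §1 Theorem ((ia) ⟺ (ic))] -/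
theorem IsIsogenous.not_closure_span_curveCoords_ratPolyhedral_of_prod [Nontrivial F] {Φ : (ι → ℝ) ≃L[ℝ] E}
    (h : IsIsogenous Φ (prodPeriod Ψ Ψ)) (hY : IsAbelianVariety Ψ) (e : Fin (2 * g) ≃ ι)
    (b : Basis (Fin n) ℤ (neronSeveriGroup Φ)) :
    ¬ ∃ (m : ℕ) (q : Fin m → Fin n → ℚ),
        closure (Submodule.span ℝ≥0 {w : Fin n → ℝ | ∃ (C : Set (ComplexTorus Φ))
          (hC : HasPureDim 𝓘(ℂ, E) C 1), IsIrreducibleAnalyticSet 𝓘(ℂ, E) C ∧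
            w = fun j ↦ (analyticCyclePeriod Φ hC (ofRealForm (-((b j : neronSeveriGroup Φ) : E [⋀^Fin 2]→L[ℝ] ℝ)))).re} :
              Set (Fin n → ℝ)) =
          {w | ∃ l : Fin m → ℝ, (∀ i, 0 ≤ l i) ∧ ∑ i, l i • (fun k ↦ (q i k : ℝ)) = w} := fun hia ↦
  h.not_exists_finset_addSubmonoidClosure_eq_of_prod Ψ hY
    (((((h.isAbelianVariety_iff).2 (hY.prod hY)).coneOfCurves_ratPolyhedral_tfae Φ e b).out 0 3).1 hia)

variable {κ₁ κ₂ : Type*} [Fintype κ₁] [Fintype κ₂] [DecidableEq κ₁] [DecidableEq κ₂] {F₁ F₂ : Type*}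
  [NormedAddCommGroup F₁] [NormedSpace ℂ F₁] [NormedAddCommGroup F₂] [NormedSpace ℂ F₂]
  (Ψ₁ : (κ₁ → ℝ) ≃L[ℝ] F₁) (Ψ₂ : (κ₂ → ℝ) ≃L[ℝ] F₂)

/-- **Rosoff's (2) read on the cone of curves: for elliptic curves `E₁, E₂`, `NE̅(E₁ × E₂)` is rational
polyhedral iff `E₁` and `E₂` are NOT isogenous** (for any complex torus `X ∼ E₁ × E₂`, `Eᵢ` one-dimensional:
file 56, `exists_finset_addSubmonoidClosure_eq_prod_iff_not_isIsogenous_of_finrank_eq_one` and Lemma 4.1,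
transported along (ia) ⟺ (ic); "the theorem of course contains statement (2)"). [cite: Bauer1998ConeOfCurves, §1 statement (2), the remark after the Theorem, and §4 Thm. 4.2] -/
theorem IsIsogenous.closure_span_curveCoords_ratPolyhedral_iff_not_isIsogenous_of_finrank_eq_one
    {Φ : (ι → ℝ) ≃L[ℝ] E} (h : IsIsogenous Φ (prodPeriod Ψ₁ Ψ₂)) (h1 : finrank ℂ F₁ = 1) (h2 : finrank ℂ F₂ = 1)
    (e : Fin (2 * g) ≃ ι) (b : Basis (Fin n) ℤ (neronSeveriGroup Φ)) :
    (∃ (m : ℕ) (q : Fin m → Fin n → ℚ),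
        closure (Submodule.span ℝ≥0 {w : Fin n → ℝ | ∃ (C : Set (ComplexTorus Φ))
          (hC : HasPureDim 𝓘(ℂ, E) C 1), IsIrreducibleAnalyticSet 𝓘(ℂ, E) C ∧
            w = fun j ↦ (analyticCyclePeriod Φ hC (ofRealForm (-((b j : neronSeveriGroup Φ) : E [⋀^Fin 2]→L[ℝ] ℝ)))).re} :
              Set (Fin n → ℝ)) =
          {w | ∃ l : Fin m → ℝ, (∀ i, 0 ≤ l i) ∧ ∑ i, l i • (fun k ↦ (q i k : ℝ)) = w}) ↔
      ¬ IsIsogenous Ψ₁ Ψ₂ := by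
  have hA₁ := (isSimple_and_isAbelianVariety_of_finrank_eq_one Ψ₁ h1).2.2.1
  have hA₂ := (isSimple_and_isAbelianVariety_of_finrank_eq_one Ψ₂ h2).2.2.1
  have hX : IsAbelianVariety Φ := (h.isAbelianVariety_iff).2 (hA₁.prod hA₂)
  exact (((hX.coneOfCurves_ratPolyhedral_tfae Φ e b).out 0 3).trans
    (h.exists_finset_addSubmonoidClosure_eq_iff Φ (prodPeriod Ψ₁ Ψ₂))).trans
      (exists_finset_addSubmonoidClosure_eq_prod_iff_not_isIsogenous_of_finrank_eq_one Ψ₁ Ψ₂ h1 h2)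

/-- **Rosoff's (2), as printed, read on the cone of curves: "For elliptic curves `E₁` and `E₂`, `N(E₁ × E₂)`
is finitely generated if and only if `rk NS(E₁ × E₂) = 2`"** — for any complex torus `X ∼ E₁ × E₂` with
one-dimensional `Eᵢ`, `NE̅(X)` is rational polyhedral iff `ρ(X) = 2` (`ρ` is an isogeny invariant).
[cite: Bauer1998ConeOfCurves, §1 statement (2) and the remark after the Theorem] [cite: HulekLaface2019PicardNumbersAV, §2.1 Prop. 2.2] -/
theorem IsIsogenous.closure_span_curveCoords_ratPolyhedral_iff_finrank_eq_two_of_finrank_eq_one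
    {Φ : (ι → ℝ) ≃L[ℝ] E} (h : IsIsogenous Φ (prodPeriod Ψ₁ Ψ₂)) (h1 : finrank ℂ F₁ = 1) (h2 : finrank ℂ F₂ = 1)
    (e : Fin (2 * g) ≃ ι) (b : Basis (Fin n) ℤ (neronSeveriGroup Φ)) :
    (∃ (m : ℕ) (q : Fin m → Fin n → ℚ),
        closure (Submodule.span ℝ≥0 {w : Fin n → ℝ | ∃ (C : Set (ComplexTorus Φ))
          (hC : HasPureDim 𝓘(ℂ, E) C 1), IsIrreducibleAnalyticSet 𝓘(ℂ, E) C ∧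
            w = fun j ↦ (analyticCyclePeriod Φ hC (ofRealForm (-((b j : neronSeveriGroup Φ) : E [⋀^Fin 2]→L[ℝ] ℝ)))).re} :
              Set (Fin n → ℝ)) =
          {w | ∃ l : Fin m → ℝ, (∀ i, 0 ≤ l i) ∧ ∑ i, l i • (fun k ↦ (q i k : ℝ)) = w}) ↔
      finrank ℤ (neronSeveriGroup Φ) = 2 := by
  have hA₁ := (isSimple_and_isAbelianVariety_of_finrank_eq_one Ψ₁ h1).2.2.1
  have hA₂ := (isSimple_and_isAbelianVariety_of_finrank_eq_one Ψ₂ h2).2.2.1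
  have hX : IsAbelianVariety Φ := (h.isAbelianVariety_iff).2 (hA₁.prod hA₂)
  rw [h.finrank_neronSeveriGroup_eq]
  exact (((hX.coneOfCurves_ratPolyhedral_tfae Φ e b).out 0 3).trans
    (h.exists_finset_addSubmonoidClosure_eq_iff Φ (prodPeriod Ψ₁ Ψ₂))).trans
      (exists_finset_addSubmonoidClosure_eq_prod_iff_finrank_neronSeveriGroup_eq_two Ψ₁ Ψ₂ h1 h2)

variable {ρ : Type*} [Fintype ρ] [DecidableEq ρ] {τ : ρ → Type*} [∀ ν, Fintype (τ ν)] [∀ ν, DecidableEq (τ ν)]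
  {G : ρ → Type*} [∀ ν, NormedAddCommGroup (G ν)] [∀ ν, NormedSpace ℂ (G ν)]
  (X : ∀ ν, (τ ν → ℝ) ≃L[ℝ] G ν) (nX : ρ → ℕ)

/-- **Bauer 1998, Theorem 4.2, read on the cone of curves.** "Consider an arbitrary abelian variety `X`. It
is isogenous to a product `X₁^{n₁} × … × X_r^{n_r}` with integers `nᵢ ≥ 1`, where the `Xᵢ` are simple and
mutually non-isogenous abelian varieties. The semi-group `N(X)` is finitely generated if and only if
`NS(Xᵢ) ≅ ℤ` and `nᵢ = 1` for `1 ≤ i ≤ r`" — by the Theorem ((ia) ⟺ (ic)), for any isogeny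
`X ∼ ∏_ν X_ν^{n_ν}` onto powers of simple, nonzero, pairwise non-isogenous tori (`n_ν ≥ 1`; such a Poincaré
decomposition exists and the `X_ν` are abelian varieties, file 54): **`NE̅(X)` is rational polyhedral iff
`NS(X_ν) ≅ ℤ` and `n_ν = 1` for every `ν`.** [cite: Bauer1998ConeOfCurves, §4 Thm. 4.2 and §1 Theorem ((ia) ⟺ (ic))] [cite: Lange2023AbelianVarietiesComplex, §2.4.4 Thm. 2.4.25] -/
theorem IsAbelianVariety.closure_span_curveCoords_ratPolyhedral_iff_of_isIsogenous_powers [∀ ν, Nonempty (τ ν)]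
    (hX : IsAbelianVariety Φ) (hiso : IsIsogenous Φ (sigmaPiPeriod fun ν ↦ powPeriod (X ν) (nX ν)))
    (hXs : ∀ ν, IsSimple (X ν)) (hXX : ∀ ν ν', ν ≠ ν' → ¬ IsIsogenous (X ν) (X ν')) (hn : ∀ ν, 0 < nX ν)
    (e : Fin (2 * g) ≃ ι) (b : Basis (Fin n) ℤ (neronSeveriGroup Φ)) :
    (∃ (m : ℕ) (q : Fin m → Fin n → ℚ),
        closure (Submodule.span ℝ≥0 {w : Fin n → ℝ | ∃ (C : Set (ComplexTorus Φ))
          (hC : HasPureDim 𝓘(ℂ, E) C 1), IsIrreducibleAnalyticSet 𝓘(ℂ, E) C ∧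
            w = fun j ↦ (analyticCyclePeriod Φ hC (ofRealForm (-((b j : neronSeveriGroup Φ) : E [⋀^Fin 2]→L[ℝ] ℝ)))).re} :
              Set (Fin n → ℝ)) =
          {w | ∃ l : Fin m → ℝ, (∀ i, 0 ≤ l i) ∧ ∑ i, l i • (fun k ↦ (q i k : ℝ)) = w}) ↔
      ∀ ν, finrank ℤ (neronSeveriGroup (X ν)) = 1 ∧ nX ν = 1 := by
  exact ((hX.coneOfCurves_ratPolyhedral_tfae Φ e b).out 0 3).trans
    (hX.exists_finset_addSubmonoidClosure_eq_iff_of_isIsogenous_powers X nX hiso hXs hXX hn)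

end ComplexTorus

end Literature.Geometry.Kaehler

end
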